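import Literature.Computability.QuantumComplexity.PolyWindowThreshold
import HarnessLib

/-!
# The BLOCK-STATISTIC read-out: a polynomial-time statistic of every copy's output string, summed and thresholded

Topic `Literature/Computability/QuantumComplexity`; sequel of `PolyWindowReadout.lean` / `PolyWindowThreshold.lean`
(count the ones in a fixed window of every block). Here the read-out applies an ARBITRARY polynomial-time string
function `statU` to `⟨z, s_j⟩`, `s_j` the output string of copy `j` (the first `|widU z|` symbols of block `j`,
`|widU z| = |z| + ancillas` the copy's own width), appends the results and finally compares the number of ones collected
with an instance-dependent rational threshold (`thrPost`). With `statU` a one-bit PREDICATE this counts the copies whose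
output satisfies a polynomial-time test (e.g. "the query register spells `σ`" — no comparator inside the quantum circuit
is needed); with `statU` emitting one flag per sub-run of a juxtaposed block it sums dependent indicators per copy. The
concentration is `PolyCopiesStatWindow.kernelProb_ge_of_stat_window`; the mean of the statistic is the sum over its
output positions of the probabilities `F.kernelProb 0 z {s | statU ⟨z,s⟩[i] = 1}` (linearity). Watrous 2009, §IV.2
Prop. 3, with classical post-processing of each run's full output (Bernstein–Vazirani 1997, §8).

* `PolyCopies.bsBody`, `bsLoop`, **`bsThrF`** (FP for `widU, statU, num, den ∈ FP`; growth polynomial via the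
  composition of the length bounds), `bsStat`, `bsCount`, **`bsThrF_boolPair`** (the bit
  `[⟦num z⟧·K ≤ ⟦den z⟧·Σ_j #ones(statU ⟨z, s_j⟩)]`);
* `QCircuitFamily.copyWidthFn` — `z ↦ z ++ 1^{ancillas |z|}` (unary copy width, FP for uniform families);
* `PolyCopies.bsMean G statU M z = Σ_{i<M z} G.kernelProb 0 z {s | (statU ⟨z,s⟩).getD i = 1}`;
* **`mem_PromiseBQP_of_blockStat_thresholds_pre`** — `PromiseBQP` from a uniform oracle-free `G`, a pre-processor `h`,
  and a block statistic whose mean separates the instance-dependent threshold by an inverse polynomial.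

Everything here is PROVED; definitions are explicit string functions / a real number.

## References

* J. Watrous, *Quantum computational complexity*, Springer Encyclopedia 2009 (arXiv:0804.3401), §IV.2 Prop. 3 [Watrous2009].
* E. Bernstein, U. Vazirani, *Quantum complexity theory*, SIAM J. Comput. 26 (1997), §8 [BernsteinVazirani1997].
* S. Arora, B. Barak, *Computational Complexity: A Modern Approach*, CUP 2009, §1.3, Appendix A [AroraBarak2009].
-/

noncomputable section

namespace Literature.Computability.Cryptography.QCircuitFamily

open _root_.Computability Literature.Computability.Complexity Literature.Computability.Complexity.Brick

variable {G : QGateSet} [Encodable G.Op]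

/-- **The copy width in unary**: `z ↦ z ++ 1^{ancillas |z|}`, a string of length `|z| + F.ancillas |z|` (read off the
description `F.descFn z = ⟨bin |z|, ⟨1^{anc}, code⟩⟩`). [cite: AroraBarak2009, §6.2 (descriptions of uniform families)] -/
def copyWidthFn (F : QCircuitFamily G) : List Bool → List Bool :=
  appF ∘ fanoutFn (fun z => z) (fstF ∘ sndF ∘ F.descFn)

/-- The length of `copyWidthFn`. [cite: AroraBarak2009, §6.2] -/
@[simp] theorem length_copyWidthFn (F : QCircuitFamily G) (z : List Bool) :
    (F.copyWidthFn z).length = z.length + F.ancillas z.length := by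
  simp [copyWidthFn, fanoutFn_apply, descFn_eq]
  exact _root_.Computability.unary_decode_encode_nat _

/-- `copyWidthFn ∈ FP` for a uniform family. [cite: AroraBarak2009, §6.2 Remark 6.7] -/
theorem copyWidthFn_mem_FP {F : QCircuitFamily G} (hU : F.IsUniform) : F.copyWidthFn ∈ FP :=
  comp_mem_FP appF_mem_FP (fanoutFn_mem_FP (PolyTimeComputable.id _)
    (comp_mem_FP fstF_mem_FP (comp_mem_FP sndF_mem_FP (descFn_mem_FP_of_isUniform hU))))

end Literature.Computability.Cryptography.QCircuitFamily

namespace Literature.Computability.QuantumComplexity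

open _root_.Computability Polynomial Complexity Complexity.Brick Plumb HashBricks Cryptography Finset

namespace PolyCopies

variable (P : Params) (widU statU num den : List Bool → List Bool)

/-! ### The block-statistic loop -/

/-- The body on records `⟨x, ⟨cnt, ⟨acc, rest⟩⟩⟩`: prepend `statU ⟨x, rest.take |widU x|⟩` to `acc`, drop one block
width of `rest`. [cite: AroraBarak2009, §1.3 (bounded loops)] -/
def bsBody : List Bool → List Bool :=
  fanoutFn (appF ∘ fanoutFn (statU ∘ fanoutFn (nthF 0) (takeFn ∘ fanoutFn (widU ∘ nthF 0) (sndPow 2))) (nthF 2))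
    (dropFn ∘ fanoutFn (polyFn (bPoly P) ∘ nthF 0) (sndPow 2))

/-- The loop: `K(|x|)` rounds of `bsBody`. [cite: AroraBarak2009, §1.3] -/
def bsLoop : List Bool → List Bool := fun z => (loopStep (bsBody P widU statU))^[(KPoly P).eval (fstF z).length] z

/-- **The block-statistic threshold read-out.** [cite: Watrous2009, §IV.2 Prop. 3 (proof)] -/
def bsThrF : List Bool → List Bool := thrPost P num den ∘ bsLoop P widU statU ∘ majInit P

variable {P widU statU num den}

/-- Growth of the body. [cite: AroraBarak2009, §1.3] -/
theorem length_bsBody_le (z : List Bool) :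
    (bsBody P widU statU z).length ≤ (sndPow 1 z).length +
      (2 * (statU (boolPair (nthF 0 z) ((sndPow 2 z).take (widU (nthF 0 z)).length))).length + 4) := by
  have h1 : 2 * (nthF 2 z).length + (sndPow 2 z).length ≤ (sndPow 1 z).length := length_nthF_succ_add_sndPow_succ_le 1 z
  have hdrop : (dropFn (boolPair (polyFn (bPoly P) (nthF 0 z)) (sndPow 2 z))).length ≤ (sndPow 2 z).length := by
    rw [dropFn_boolPair, List.length_drop]; exact Nat.sub_le _ _
  simp only [bsBody, fanoutFn_apply, Function.comp_apply, length_boolPair, appF, fstF_boolPair, sndF_boolPair,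
    List.length_append, takeFn_boolPair]
  omega

/-- `bsBody ∈ FP`. [cite: AroraBarak2009, §1.3] -/
theorem bsBody_mem_FP (hwid : widU ∈ FP) (hstat : statU ∈ FP) : bsBody P widU statU ∈ FP :=
  fanoutFn_mem_FP
    (comp_mem_FP appF_mem_FP (fanoutFn_mem_FP
      (comp_mem_FP hstat (fanoutFn_mem_FP (nthF_mem_FP 0)
        (comp_mem_FP takeFn_mem_FP (fanoutFn_mem_FP (comp_mem_FP hwid (nthF_mem_FP 0)) (sndPow_mem_FP 2)))))
      (nthF_mem_FP 2)))
    (comp_mem_FP dropFn_mem_FP (fanoutFn_mem_FP (comp_mem_FP (polyFn_mem_FP _) (nthF_mem_FP 0)) (sndPow_mem_FP 2)))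

/-- `bsLoop ∈ FP`: the statistic's output length is polynomial in `|x|` (composition of the length bounds of `statU`
and `widU`). [cite: AroraBarak2009, §1.3] -/
theorem bsLoop_mem_FP (hwid : widU ∈ FP) (hstat : statU ∈ FP) : bsLoop P widU statU ∈ FP := by
  obtain ⟨Gw, hGw⟩ := exists_poly_length_le_of_mem_FP hwid
  obtain ⟨Gs, hGs⟩ := exists_poly_length_le_of_mem_FP hstat
  refine loopFn_mem_FP_of_poly (bsBody_mem_FP hwid hstat) (2 * Gs.comp (2 * X + 2 + Gw) + 4) (fun z => ?_) (KPoly P)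
  have h := length_bsBody_le (P := P) (widU := widU) (statU := statU) z
  set x := nthF 0 z with hx
  have hx' : fstF z = x := rfl
  have hlen : (boolPair x ((sndPow 2 z).take (widU x).length)).length ≤ 2 * x.length + 2 + Gw.eval x.length := by
    rw [length_boolPair]
    have := List.length_take_le (widU x).length (sndPow 2 z)
    have := hGw x
    omega
  have hs : (statU (boolPair x ((sndPow 2 z).take (widU x).length))).length ≤ (Gs.comp (2 * X + 2 + Gw)).eval x.length := by
    refine (hGs _).trans ?_
    rw [Polynomial.eval_comp]
    refine TM2Iter.eval_mono Gs ?_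
    simpa [Polynomial.eval_add, Polynomial.eval_mul] using hlen
  have hev : (2 * Gs.comp (2 * X + 2 + Gw) + 4 : Polynomial ℕ).eval (fstF z).length =
      2 * (Gs.comp (2 * X + 2 + Gw)).eval x.length + 4 := by
    rw [hx']; simp [Polynomial.eval_add, Polynomial.eval_mul]
  rw [hev]
  omega

/-- **The block-statistic read-out is polynomial time.** [cite: Watrous2009, §IV.2 Prop. 3 (proof)] -/
theorem bsThrF_mem_FP (hwid : widU ∈ FP) (hstat : statU ∈ FP) (hnum : num ∈ FP) (hden : den ∈ FP) :
    bsThrF P widU statU num den ∈ FP :=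
  comp_mem_FP (thrPost_mem_FP hnum hden) (comp_mem_FP (bsLoop_mem_FP hwid hstat) majInit_mem_FP)

/-! ### Semantics -/

/-- The collected statistics after `i` rounds (latest first). [cite: Watrous2009, §IV.2 Prop. 3 (proof)] -/
def bsAcc (x y : List Bool) : ℕ → List Bool
  | 0 => []
  | i + 1 => statU (boolPair x ((restAt (P := P) x.length y i).take (widU x).length)) ++ bsAcc x y i

/-- One round of the body on a well-formed record. [cite: AroraBarak2009, §1.3] -/
theorem bsBody_record (x c y : List Bool) (i : ℕ) :
    bsBody P widU statU (boolPair x (boolPair c (boolPair (bsAcc (P := P) (widU := widU) (statU := statU) x y i)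
        (restAt (P := P) x.length y i)))) =
      boolPair (bsAcc (P := P) (widU := widU) (statU := statU) x y (i + 1)) (restAt (P := P) x.length y (i + 1)) := by
  simp only [bsBody, fanoutFn_apply, Function.comp_apply, sndPow_succ_boolPair, sndPow_zero_boolPair, nthF_succ_boolPair,
    nthF_zero_boolPair, takeFn_boolPair, dropFn_boolPair, polyFn_apply, eval_bPoly, appF, fstF_boolPair, sndF_boolPair,
    bsAcc, restAt, List.drop_drop, ones, List.length_replicate]
  congr 2
  ring

/-- The loop model runs the rounds. [cite: AroraBarak2009, §1.3] -/
theorem loopModel_bsBody (x y : List Bool) : ∀ (k i : ℕ),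
    loopModel (bsBody P widU statU) x k (boolPair (bsAcc (P := P) (widU := widU) (statU := statU) x y i)
        (restAt (P := P) x.length y i)) =
      boolPair (bsAcc (P := P) (widU := widU) (statU := statU) x y (i + k)) (restAt (P := P) x.length y (i + k))
  | 0, i => rfl
  | k + 1, i => by
    rw [loopModel, bsBody_record, loopModel_bsBody x y k (i + 1)]
    congr 2 <;> ring

/-- The statistic of block `j`: `#ones (statU ⟨x, (y.drop (blk j 0)).take |widU x|⟩)`. [cite: Watrous2009, §IV.2 Prop. 3 (proof)] -/
def bsStat (x y : List Bool) (j : ℕ) : ℕ :=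
  (statU (boolPair x ((y.drop (blk P x.length j 0)).take (widU x).length))).count true

/-- Counting the collected ones. [cite: Watrous2009, §IV.2 Prop. 3 (proof)] -/
theorem count_bsAcc (x y : List Bool) : ∀ i : ℕ,
    (bsAcc (P := P) (widU := widU) (statU := statU) x y i).count true =
      ∑ j ∈ Finset.range i, bsStat (P := P) (widU := widU) (statU := statU) x y j
  | 0 => by simp [bsAcc]
  | i + 1 => by
    have hpos : blk P x.length i 0 = base P x.length + i * b P x.length := by unfold blk; omega
    rw [bsAcc, List.count_append, count_bsAcc x y i, Finset.sum_range_succ, add_comm]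
    all_goals simp only [bsStat, restAt, hpos]

/-- The total statistic over the `K(|x|)` blocks. [cite: Watrous2009, §IV.2 Prop. 3 (proof)] -/
def bsCount (x y : List Bool) : ℕ :=
  ∑ j ∈ Finset.range (K P x.length), bsStat (P := P) (widU := widU) (statU := statU) x y j

/-- **Semantics of the block-statistic read-out**: the bit `[⟦num x⟧ · K(|x|) ≤ ⟦den x⟧ · bsCount x y]`.
[cite: Watrous2009, §IV.2 Prop. 3 (proof)] -/
theorem bsThrF_boolPair (x y : List Bool) :
    bsThrF P widU statU num den (boolPair x y) =
      [decide (bitsToNat (num x) * K P x.length ≤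
        bitsToNat (den x) * bsCount (P := P) (widU := widU) (statU := statU) x y)] := by
  have hinit : majInit P (boolPair x y) =
      boolPair x (boolPair (encodeNat (K P x.length))
        (boolPair (bsAcc (P := P) (widU := widU) (statU := statU) x y 0) (restAt (P := P) x.length y 0))) := by
    simp [majInit, fanoutFn_apply, bsAcc, restAt, ones]
  have hloop : bsLoop P widU statU (majInit P (boolPair x y)) =
      boolPair x (boolPair [] (boolPair (bsAcc (P := P) (widU := widU) (statU := statU) x y (K P x.length))
        (restAt (P := P) x.length y (K P x.length)))) := by
    rw [bsLoop, hinit, fstF_boolPair, eval_KPoly,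
      iterate_loopStep (bsBody P widU statU) x (K P x.length) (K P x.length) _ le_rfl,
      loopModel_bsBody x y (K P x.length) 0, Nat.zero_add]
  rw [bsThrF, Function.comp_apply, Function.comp_apply, hloop]
  have hlt : (ltFn ∘ fanoutFn (prodFn ∘ fanoutFn (den ∘ nthF 0) (popCountFn ∘ nthF 2))
      (prodFn ∘ fanoutFn (num ∘ nthF 0) (lenBinF ∘ polyFn (KPoly P) ∘ nthF 0)))
      (boolPair x (boolPair [] (boolPair (bsAcc (P := P) (widU := widU) (statU := statU) x y (K P x.length))
        (restAt (P := P) x.length y (K P x.length))))) =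
      [decide (bitsToNat (den x) * bsCount (P := P) (widU := widU) (statU := statU) x y <
        bitsToNat (num x) * K P x.length)] := by
    simp only [Function.comp_apply, fanoutFn_apply, nthF_zero_boolPair, nthF_succ_boolPair, polyFn_apply, eval_KPoly,
      lenBinF_apply, ones, List.length_replicate, popCountFn_apply, ltFn_boolPair, prodFn_boolPair, bitsToNat_encodeNat,
      count_bsAcc, bsCount]
    congr 1
  rw [thrPost, notFn_apply hlt]
  simp only [List.cons.injEq, and_true]
  rw [← decide_not, decide_eq_decide]
  exact not_lt

/-! ### Link with the measured register -/

/-- The part of block `j` handed to the statistic is the copy string of block `j`, when the width is the copy width.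
[cite: NielsenChuang2010, §2.2.8] -/
theorem take_drop_ofFn_blk (x : List Bool) (z : QReg (x.length + anc P x.length)) (j : Fin (K P x.length)) :
    ((List.ofFn z).drop (blk P x.length j 0)).take (x.length + P.F.ancillas x.length) =
      List.ofFn ((z ∘ blockEmb P x.length j) ∘ Fin.castLEEmb (copy_fits x.length)) := by
  apply List.ext_getElem
  · have hlt : blk P x.length j 0 < x.length + anc P x.length := (ansW (P := P) x.length j).isLt
    have h1 : blk P x.length j 0 + (x.length + P.F.ancillas x.length) ≤ x.length + anc P x.length := by
      have hb := copy_fits (P := P) x.length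
      rcases Nat.eq_zero_or_pos (x.length + P.F.ancillas x.length) with h0 | hpos
      · omega
      · have := blk_fits (P := P) (n := x.length) (j := j) j.isLt (i := x.length + P.F.ancillas x.length - 1) (by omega)
        rw [blk_eq_add] at this
        omega
    simp only [List.length_take, List.length_drop, List.length_ofFn]
    omega
  · intro i hi hi'
    simp only [List.length_ofFn] at hi'
    have h2 : blk P x.length j 0 + i < x.length + anc P x.length := by
      have := blk_fits (P := P) (n := x.length) (j := j) j.isLt (i := i)
        (by have := copy_fits (P := P) x.length; omega)
      rw [blk_eq_add] at this; exact this
    rw [List.getElem_take, List.getElem_drop, List.getElem_ofFn, List.getElem_ofFn]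
    simp only [Function.comp_apply, Fin.castLEEmb_apply]
    congr 1

/-- **The mean of a string statistic** applied to the copy's output: the sum over its output positions of the
probabilities that the position reads `1`. [cite: NielsenChuang2010, §2.2.8] [cite: AroraBarak2009, Appendix A (linearity of expectation)] -/
def bsMean (G : QCircuitFamily cliffordT) (statU : List Bool → List Bool) (M : List Bool → ℕ) (z : List Bool) : ℝ :=
  ∑ i ∈ Finset.range (M z), G.kernelProb 0 z {s | (statU (boolPair z s)).getD i false = true}

/-- A count of ones is the positional sum up to any bound on the length. [cite: AroraBarak2009, §1.3] -/
theorem count_eq_sum_getD (L : List Bool) {M : ℕ} (hM : L.length ≤ M) :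
    (L.count true : ℕ) = ∑ i ∈ Finset.range M, if L.getD i false = true then 1 else 0 := by
  have h := count_take_drop_eq_sum L 0 M
  rw [List.drop_zero, List.take_of_length_le hM] at h
  simpa using h

end PolyCopies

/-! ### The `PromiseBQP` statement -/

open PolyCopies in
/-- **`PromiseBQP` from a one-shot estimator read through a polynomial-time BLOCK STATISTIC.** Let `h ∈ FP` pre-process,
`G` be uniform and oracle-free, `statU ∈ FP` a string statistic applied to `⟨z, s⟩` (`s` the output string of a run of
`G` on `z = h v`) with `|statU ⟨z, s⟩| ≤ M z`, and suppose its mean `bsMean G statU M (h v)` is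
`≥ ⟦num(h v)⟧/⟦den(h v)⟧ + 1/(q(|h v|)+1)` on YES instances and `≤ … − 1/(q(|h v|)+1)` on NO instances (`num, den ∈ FP`,
`⟦den⟧ > 0` on the promise). Then the promise problem is in `PromiseBQP`.
[cite: Watrous2009, §IV.2 Prop. 3] [cite: BernsteinVazirani1997, §8] -/
theorem mem_PromiseBQP_of_blockStat_thresholds_pre (Q : PromiseProblem) {h : List Bool → List Bool} (hh : h ∈ FP)
    {G : QCircuitFamily cliffordT} (hG : G.IsOracleFree) (hU : G.IsUniform)
    {statU num den : List Bool → List Bool} (hstat : statU ∈ FP) (hnum : num ∈ FP) (hden : den ∈ FP)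
    (M : List Bool → ℕ) (hM : ∀ z s, s.length = z.length + G.ancillas z.length → (statU (boolPair z s)).length ≤ M z)
    (q : Polynomial ℕ)
    (hdenY : ∀ v ∈ Q.yes, 0 < bitsToNat (den (h v))) (hdenN : ∀ v ∈ Q.no, 0 < bitsToNat (den (h v)))
    (hyes : ∀ v ∈ Q.yes,
      (bitsToNat (num (h v)) : ℝ) / bitsToNat (den (h v)) + 1 / (((q.eval (h v).length : ℕ) : ℝ) + 1) ≤
        bsMean G statU M (h v))
    (hno : ∀ v ∈ Q.no,
      bsMean G statU M (h v) ≤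
        (bitsToNat (num (h v)) : ℝ) / bitsToNat (den (h v)) - 1 / (((q.eval (h v).length : ℕ) : ℝ) + 1)) :
    Q ∈ PromiseBQP := by
  classical
  obtain ⟨pF, hpF⟩ := QCircuitFamily.IsUniform.isPolySize' hU
  obtain ⟨Gs, hGs⟩ := exists_poly_length_le_of_mem_FP hstat
  -- a polynomial bound of the statistic on copy strings: |⟨z, s⟩| = 3|z| + 2 + anc ≤ 3|z| + 2 + pF |z|
  let C : Polynomial ℕ := Gs.comp (3 * X + 2 + pF)
  let P₀ : PolyCopies.Params := ⟨G, pF, fun n => (hpF n).2, 3 * C ^ 2 * (q + 1) ^ 2⟩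
  have hRfree : (PolyCopies.family P₀).IsOracleFree := PolyCopies.family_isOracleFree P₀ hG
  have hRU : (PolyCopies.family P₀).IsUniform := PolyCopies.family_isUniform P₀ hU
  have hwidFP : G.copyWidthFn ∈ FP := QCircuitFamily.copyWidthFn_mem_FP hU
  have hg : (PolyCopies.bsThrF P₀ G.copyWidthFn statU num den ∘ mapFstFn h) ∈ FP :=
    comp_mem_FP (PolyCopies.bsThrF_mem_FP (P := P₀) hwidFP hstat hnum hden) (mapFstFn_mem_FP hh)
  obtain ⟨P, hPh, hPg, hPF⟩ := CWrap.exists_params hh hg hRU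
  have hKeq : ∀ z : List Bool, (PolyCopies.K P₀ z.length : ℝ) =
      3 * ((C.eval z.length : ℕ) : ℝ) ^ 2 * (((q.eval z.length : ℕ) : ℝ) + 1) ^ 2 + 1 := by
    intro z
    show (((3 * C ^ 2 * (q + 1) ^ 2).eval z.length + 1 : ℕ) : ℝ) = _
    push_cast [Polynomial.eval_add, Polynomial.eval_mul, Polynomial.eval_pow, Polynomial.eval_ofNat, Polynomial.eval_one]
    ring
  have hθ : ∀ z : List Bool, (0 : ℝ) < 1 / (((q.eval z.length : ℕ) : ℝ) + 1) := fun z => by positivity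
  -- the per-copy statistic
  let Z : ∀ z : List Bool, QReg (PolyCopies.b P₀ z.length) → ℝ := fun z v =>
    ((statU (boolPair z (List.ofFn (v ∘ Fin.castLEEmb (PolyCopies.copy_fits (P := P₀) z.length))))).count true : ℝ)
  have hlenS : ∀ (z : List Bool) (v : QReg (PolyCopies.b P₀ z.length)),
      (List.ofFn (v ∘ Fin.castLEEmb (PolyCopies.copy_fits (P := P₀) z.length))).length = z.length + G.ancillas z.length :=
    fun z v => by simp [P₀]
  have hZC : ∀ (z : List Bool) (v : QReg (PolyCopies.b P₀ z.length)),
      (statU (boolPair z (List.ofFn (v ∘ Fin.castLEEmb (PolyCopies.copy_fits (P := P₀) z.length))))).length ≤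
        C.eval z.length := by
    intro z v
    refine (hGs _).trans ?_
    simp only [C, Polynomial.eval_comp]
    refine TM2Iter.eval_mono Gs ?_
    rw [length_boolPair, hlenS]
    have := (hpF z.length).2
    simp [Polynomial.eval_add, Polynomial.eval_mul]
    omega
  have hZ : ∀ (z : List Bool) (v : QReg (PolyCopies.b P₀ z.length)), 0 ≤ Z z v ∧ Z z v ≤ ((C.eval z.length : ℕ) : ℝ) := by
    intro z v
    refine ⟨by positivity, ?_⟩
    simp only [Z]
    exact_mod_cast List.count_le_length.trans (hZC z v)
  have hmean : ∀ z : List Bool, (∑ v, ‖PolyCopies.blockState P₀ z v‖ ^ 2 * Z z v) = bsMean G statU M z := by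
    intro z
    have e : ∀ v : QReg (PolyCopies.b P₀ z.length), Z z v =
        (((Finset.range (M z)).filter fun i =>
          List.ofFn (v ∘ Fin.castLEEmb (PolyCopies.copy_fits (P := P₀) z.length)) ∈
            ({s : List Bool | (statU (boolPair z s)).getD i false = true} : Set (List Bool))).card : ℝ) := by
      intro v
      simp only [Z]
      rw [count_eq_sum_getD _ (hM z _ (hlenS z v))]
      push_cast
      rw [Finset.card_filter]
      push_cast
      refine Finset.sum_congr rfl fun i _ => ?_
      simp only [Set.mem_setOf_eq]
    simp_rw [e]
    rw [PolyCopies.sum_normSq_blockState_mul_eventCount (P := P₀) z (M z)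
      (fun i => ({s : List Bool | (statU (boolPair z s)).getD i false = true} : Set (List Bool)))]
    rfl
  have hbound : ∀ z : List Bool,
      ((C.eval z.length : ℕ) : ℝ) ^ 2 / (4 * PolyCopies.K P₀ z.length * (1 / (((q.eval z.length : ℕ) : ℝ) + 1)) ^ 2) ≤
        1 / 12 := by
    intro z
    rw [hKeq z]
    have hq1 : (0 : ℝ) < ((q.eval z.length : ℕ) : ℝ) + 1 := by positivity
    have hc0 : (0 : ℝ) ≤ ((C.eval z.length : ℕ) : ℝ) := Nat.cast_nonneg _
    rw [div_le_div_iff₀ (by positivity) (by norm_num)]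
    have hpos : (0 : ℝ) ≤ (((q.eval z.length : ℕ) : ℝ) + 1) ^ 2 := sq_nonneg _
    field_simp
    nlinarith [mul_nonneg (sq_nonneg ((C.eval z.length : ℕ) : ℝ)) hpos]
  have hcount : ∀ (z : List Bool) (z' : QReg (z.length + PolyCopies.anc P₀ z.length)),
      (∑ j : Fin (PolyCopies.K P₀ z.length), Z z (z' ∘ PolyCopies.blockEmb P₀ z.length j)) =
        (PolyCopies.bsCount (P := P₀) (widU := G.copyWidthFn) (statU := statU) z (List.ofFn z') : ℝ) := by
    intro z z'
    simp only [Z, PolyCopies.bsCount]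
    push_cast
    rw [← Fin.sum_univ_eq_sum_range]
    refine Finset.sum_congr rfl fun j _ => ?_
    simp only [PolyCopies.bsStat, QCircuitFamily.length_copyWidthFn]
    rw [PolyCopies.take_drop_ofFn_blk (P := P₀) z z' j]
    rfl
  have hgval : ∀ v y : List Bool, (PolyCopies.bsThrF P₀ G.copyWidthFn statU num den ∘ mapFstFn h) (boolPair v y) =
      PolyCopies.bsThrF P₀ G.copyWidthFn statU num den (boolPair (h v) y) := by
    intro v y
    rw [Function.comp_apply, mapFstFn_boolPair]
  refine ⟨CWrap.family P, CWrap.family_isOracleFree P (hPF ▸ hRfree), CWrap.family_isUniform P (hPF ▸ hRU),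
    fun v hv => ?_, fun v hv => ?_⟩
  · have hker := CWrap.kernelProb_family_ge P v
      (fun z => {y | PolyCopies.bsThrF P₀ G.copyWidthFn statU num den (boolPair z y) = [true]})
    rw [hPh, hPg, hPF] at hker
    have hsub : {z' | ∃ y ∈ ({y | PolyCopies.bsThrF P₀ G.copyWidthFn statU num den (boolPair (h v) y) = [true]} :
        Set (List Bool)), (PolyCopies.bsThrF P₀ G.copyWidthFn statU num den ∘ mapFstFn h) (boolPair v y) <+: z'} ⊆
        {z' | [true] <+: z'} := by
      rintro z' ⟨y, hy, hz⟩
      rw [Set.mem_setOf_eq] at hy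
      rw [hgval, hy] at hz
      exact hz
    rw [← kernelProb_prefix_true_eq_acceptProbOn]
    have hd : (0 : ℝ) < bitsToNat (den (h v)) := by exact_mod_cast hdenY v hv
    have h1 := PolyCopies.kernelProb_ge_of_stat_window (P := P₀) (h v) (Z (h v)) (hZ (h v)) (hθ (h v))
      {y | PolyCopies.bsThrF P₀ G.copyWidthFn statU num den (boolPair (h v) y) = [true]} fun z' hz' => by
        rw [Set.mem_setOf_eq, PolyCopies.bsThrF_boolPair]
        simp only [List.cons.injEq, and_true, decide_eq_true_eq]
        rw [hmean (h v), hcount (h v) z'] at hz'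
        have hlow := (abs_lt.mp hz').1
        have hK0 : (0 : ℝ) ≤ (PolyCopies.K P₀ (h v).length : ℝ) := Nat.cast_nonneg _
        have h2 := mul_le_mul_of_nonneg_right (hyes v hv) hK0
        rw [add_mul] at h2
        have hW : (bitsToNat (num (h v)) : ℝ) / bitsToNat (den (h v)) * (PolyCopies.K P₀ (h v).length : ℝ) <
            (PolyCopies.bsCount (P := P₀) (widU := G.copyWidthFn) (statU := statU) (h v) (List.ofFn z') : ℝ) := by
          linarith
        rw [div_mul_eq_mul_div, div_lt_iff₀ hd] at hW
        have h3 : (bitsToNat (num (h v)) : ℝ) * (PolyCopies.K P₀ (h v).length : ℝ) ≤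
            (bitsToNat (den (h v)) : ℝ) *
              (PolyCopies.bsCount (P := P₀) (widU := G.copyWidthFn) (statU := statU) (h v) (List.ofFn z') : ℝ) := by
          linarith
        exact_mod_cast h3
    have h1' : (11 : ℝ) / 12 ≤ (PolyCopies.family P₀).kernelProb 0 (h v)
        {y | PolyCopies.bsThrF P₀ G.copyWidthFn statU num den (boolPair (h v) y) = [true]} := by
      linarith [h1, hbound (h v)]
    linarith [(h1'.trans hker).trans ((CWrap.family P).kernelProb_mono 0 v hsub)]
  · have hker := CWrap.kernelProb_family_ge P v
      (fun z => {y | PolyCopies.bsThrF P₀ G.copyWidthFn statU num den (boolPair z y) = [false]})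
    rw [hPh, hPg, hPF] at hker
    have hsub : {z' | ∃ y ∈ ({y | PolyCopies.bsThrF P₀ G.copyWidthFn statU num den (boolPair (h v) y) = [false]} :
        Set (List Bool)), (PolyCopies.bsThrF P₀ G.copyWidthFn statU num den ∘ mapFstFn h) (boolPair v y) <+: z'} ⊆
        {z' | [false] <+: z'} := by
      rintro z' ⟨y, hy, hz⟩
      rw [Set.mem_setOf_eq] at hy
      rw [hgval, hy] at hz
      exact hz
    have hd : (0 : ℝ) < bitsToNat (den (h v)) := by exact_mod_cast hdenN v hv
    have h1 := PolyCopies.kernelProb_ge_of_stat_window (P := P₀) (h v) (Z (h v)) (hZ (h v)) (hθ (h v))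
      {y | PolyCopies.bsThrF P₀ G.copyWidthFn statU num den (boolPair (h v) y) = [false]} fun z' hz' => by
        rw [Set.mem_setOf_eq, PolyCopies.bsThrF_boolPair]
        simp only [List.cons.injEq, and_true, decide_eq_false_iff_not, not_le]
        rw [hmean (h v), hcount (h v) z'] at hz'
        have hup := (abs_lt.mp hz').2
        have hK0 : (0 : ℝ) ≤ (PolyCopies.K P₀ (h v).length : ℝ) := Nat.cast_nonneg _
        have h2 := mul_le_mul_of_nonneg_right (hno v hv) hK0
        rw [sub_mul] at h2
        have hW : (PolyCopies.bsCount (P := P₀) (widU := G.copyWidthFn) (statU := statU) (h v) (List.ofFn z') : ℝ) <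
            (bitsToNat (num (h v)) : ℝ) / bitsToNat (den (h v)) * (PolyCopies.K P₀ (h v).length : ℝ) := by
          linarith
        rw [div_mul_eq_mul_div, lt_div_iff₀ hd] at hW
        have h3 : (bitsToNat (den (h v)) : ℝ) *
              (PolyCopies.bsCount (P := P₀) (widU := G.copyWidthFn) (statU := statU) (h v) (List.ofFn z') : ℝ) <
            (bitsToNat (num (h v)) : ℝ) * (PolyCopies.K P₀ (h v).length : ℝ) := by
          linarith
        exact_mod_cast h3
    have h1' : (11 : ℝ) / 12 ≤ (PolyCopies.family P₀).kernelProb 0 (h v)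
        {y | PolyCopies.bsThrF P₀ G.copyWidthFn statU num den (boolPair (h v) y) = [false]} := by
      linarith [h1, hbound (h v)]
    have h2 := (h1'.trans hker).trans ((CWrap.family P).kernelProb_mono 0 v hsub)
    have h3 := kernelProb_add_kernelProb_le_one (CWrap.family P) 0 v disjoint_prefix_true_false
    rw [kernelProb_prefix_true_eq_acceptProbOn] at h3
    linarith

end Literature.Computability.QuantumComplexity

end
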